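import Mathlib
import Summits.MatrixMultiplication.MatrixMultiplication.Theorems.SnSubsetDichotomyPolynomialSlackMatchingCostAvoid
import Summits.MatrixMultiplication.MatrixMultiplication.Theorems.SnSubsetDichotomyPolynomialSlackMatchingCostHit
import Summits.MatrixMultiplication.MatrixMultiplication.Theorems.SnSubsetDichotomyPolynomialSlackScatterCell
import Summits.MatrixMultiplication.MatrixMultiplication.Theorems.SnSubsetDichotomyPolynomialSlackBlockCounts
import Summits.MatrixMultiplication.MatrixMultiplication.Theorems.SnSubsetDichotomyPolynomialSlackStubSplit
import Summits.MatrixMultiplication.MatrixMultiplication.Theorems.SnSubsetDichotomyPolynomialSlackMarginals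

/-!
# The cost of a scattered matching (two dense quotients)

Crux `Summit.MatrixMultiplication.MatrixMultiplication.Theses.SnSubsetDichotomy.PolynomialSlack`
(item `stmt-MatrixMultiplication-8306`), level-one programme, lead c8 (two dense quotients, matching
branch: the cost of a scattered matching), line transport-split-hull, registered stub
`matchingCells_card_le`.

Let `S, T, U ⊆ S_n` have the triple product property, with quotient sets `A = S⁻¹T` and `B = T⁻¹U`
(`|A| = |S||T|`, `|B| = |T||U|` by `injOn_quot_first/second`) both DENSE: `n!/|A|, n!/|B| < 16 M`.
The profiles `dA(i,j) = #{a ∈ A : a j = i}/|A|` and `dB(j,k) = #{b ∈ B : b k = j}/|B|` are the pair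
marginals of `…PolynomialSlackMarginals` (`pairMarginal_eq_marginal_image₂`); the columns of `dB` sum
to `1`. A MATCHING `Mt` of cells `e = (k, i)` (distinct first and distinct second coordinates), each
SCATTERED (`n · Σ_j dA(i,j) dB(j,k) ≤ 1/128`), has at most `33430 (1 + log n) log(96 M)` cells:

* per cell, `scatter_cell` gives the set `Q = {j : dB(j,k) ≥ 1/(2n)}` with `Σ_Q dB(·,k) ≥ 1/2` and
  `Σ_Q dA(i,·) ≤ 1/64`;
* the cells with `|Q| ≥ n/16` make `A` AVOID `Q` at the row `i` (`#{a : a⁻¹ i ∈ Q} ≤ |A|/64`, by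
  `card_filter_inv_apply_mem`), costing `matching_cost_avoid`: at most `33100 (1+log n) log(4 n!/|A|)`;
* the cells with `|Q| < n/16` make `B` HIT `Q` at the position `k` (`#{b : b k ∈ Q} ≥ |B|/2`), costing
  `matching_cost_hit`: at most `330 (1+log n) log(6 n!/|B|)`;
* `4 n!/|A|, 6 n!/|B| < 96 M`, and `33100 + 330 = 33430`.
-/

namespace Summit.MatrixMultiplication.MatrixMultiplication.Theorems.PolynomialSlack

set_option linter.dupNamespace false

open scoped BigOperators
open Literature.Combinatorics.Additive (TripleProductProperty)

/-! ## Finset-indexed forms of the two matching costs -/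

/-- `matching_cost_avoid` for a family of cells indexed by a finset `C` (reindex along
`C.equivFin`). [folklore] -/
private theorem matchingCells_cost_avoid {n : ℕ} (hn : 1 ≤ n) (A : Finset (Equiv.Perm (Fin n)))
    (hA : A.Nonempty) {ι : Type*} (C : Finset ι) (row : ι → Fin n)
    (hrow : Set.InjOn row (C : Set ι)) (Q : ι → Finset (Fin n))
    (hQ : ∀ c ∈ C, (n : ℝ) / 16 ≤ (Q c).card)
    (havoid : ∀ c ∈ C, ((A.filter fun a => a⁻¹ (row c) ∈ Q c).card : ℝ) ≤ A.card / 64) :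
    (C.card : ℝ) ≤ 33100 * (1 + Real.log n) * Real.log (4 * n.factorial / A.card) := by
  set φ := C.equivFin with hφ
  have hinj : Function.Injective fun c : Fin C.card => row (φ.symm c).1 := by
    intro c₁ c₂ h
    have h' : (φ.symm c₁).1 = (φ.symm c₂).1 := hrow (φ.symm c₁).2 (φ.symm c₂).2 h
    exact φ.symm.injective (Subtype.ext h')
  exact matching_cost_avoid hn A hA (fun c => row (φ.symm c).1) hinj (fun c => Q (φ.symm c).1)
    (fun c => hQ _ (φ.symm c).2) (fun c => havoid _ (φ.symm c).2)

/-- `matching_cost_hit` for a family of cells indexed by a finset `C`, each set of size at most `n/8`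
(reindex along `C.equivFin`). [folklore] -/
private theorem matchingCells_cost_hit {n : ℕ} (hn : 1 ≤ n) (B : Finset (Equiv.Perm (Fin n)))
    (hB : B.Nonempty) {ι : Type*} (C : Finset ι) (col : ι → Fin n)
    (hcol : Set.InjOn col (C : Set ι)) (Q : ι → Finset (Fin n))
    (hQ : ∀ c ∈ C, ((Q c).card : ℝ) ≤ n / 8)
    (hhit : ∀ c ∈ C, (B.card : ℝ) / 2 ≤ (B.filter fun b => b (col c) ∈ Q c).card) :
    (C.card : ℝ) ≤ 330 * (1 + Real.log n) * Real.log (6 * n.factorial / B.card) := by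
  set φ := C.equivFin with hφ
  have hinj : Function.Injective fun c : Fin C.card => col (φ.symm c).1 := by
    intro c₁ c₂ h
    have h' : (φ.symm c₁).1 = (φ.symm c₂).1 := hcol (φ.symm c₁).2 (φ.symm c₂).2 h
    exact φ.symm.injective (Subtype.ext h')
  have hsum : ∑ c : Fin C.card, ((Q (φ.symm c).1).card : ℝ) ≤ C.card * n / 8 := by
    calc ∑ c : Fin C.card, ((Q (φ.symm c).1).card : ℝ) ≤ ∑ _c : Fin C.card, (n : ℝ) / 8 :=
          Finset.sum_le_sum fun c _ => hQ _ (φ.symm c).2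
      _ = C.card * n / 8 := by
          rw [Finset.sum_const, Finset.card_univ, Fintype.card_fin, nsmul_eq_mul]; ring
  exact matching_cost_hit hn B hB (fun c => col (φ.symm c).1) hinj (fun c => Q (φ.symm c).1) hsum
    (fun c => hhit _ (φ.symm c).2)

/-! ## Profiles of the quotient sets -/

/-- The columns of the profile `dB(j,k) = #{(t,u) : u k = t j}/(|T||U|)` sum to `1`
(`sum_pairMarginal_fst`). [folklore] -/
private theorem matchingCells_colsum {n : ℕ} {T U : Finset (Equiv.Perm (Fin n))}
    (hpos : 0 < T.card * U.card) (dB : Fin n → Fin n → ℝ)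
    (hdB : ∀ j k, dB j k =
      (((T ×ˢ U).filter fun tu => tu.2 k = tu.1 j).card : ℝ) / (T.card * U.card : ℕ))
    (k : Fin n) : ∑ j, dB j k = 1 := by
  have hc : ((T.card * U.card : ℕ) : ℝ) ≠ 0 := by exact_mod_cast hpos.ne'
  simp_rw [hdB]
  rw [← Finset.sum_div, div_eq_one_iff_eq hc]
  exact_mod_cast sum_pairMarginal_fst T U k

/-- Avoidance count through the profile: `#{a ∈ S⁻¹T : a⁻¹ i ∈ I} = |S||T| · Σ_{j ∈ I} dA(i,j)`
(`card_filter_inv_apply_mem` and `pairMarginal_eq_marginal_image₂`). [folklore] -/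
private theorem matchingCells_avoid_count {n : ℕ} {S T : Finset (Equiv.Perm (Fin n))}
    (hinj : Set.InjOn (fun xy : Equiv.Perm (Fin n) × Equiv.Perm (Fin n) => xy.1⁻¹ * xy.2)
      (↑S ×ˢ ↑T : Set (Equiv.Perm (Fin n) × Equiv.Perm (Fin n))))
    (dA : Fin n → Fin n → ℝ)
    (hdA : ∀ i j, dA i j =
      (((S ×ˢ T).filter fun st => st.2 j = st.1 i).card : ℝ) / (S.card * T.card : ℕ))
    (hpos : 0 < S.card * T.card) (i : Fin n) (I : Finset (Fin n)) :
    (((Finset.image₂ (fun x y : Equiv.Perm (Fin n) => x⁻¹ * y) S T).filter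
        fun a => a⁻¹ i ∈ I).card : ℝ) = (S.card * T.card : ℕ) * ∑ j ∈ I, dA i j := by
  have hc : ((S.card * T.card : ℕ) : ℝ) ≠ 0 := by exact_mod_cast hpos.ne'
  rw [card_filter_inv_apply_mem, Nat.cast_sum, Finset.mul_sum]
  refine Finset.sum_congr rfl fun j _ => ?_
  rw [hdA, pairMarginal_eq_marginal_image₂ hinj i j, mul_div_assoc', mul_div_cancel_left₀ _ hc]

/-- Fibring over the value: `#{b ∈ X : b k ∈ I} = Σ_{j ∈ I} #{b ∈ X : b k = j}`. [folklore] -/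
private theorem matchingCells_card_filter_apply_mem {n : ℕ} (X : Finset (Equiv.Perm (Fin n)))
    (I : Finset (Fin n)) (k : Fin n) :
    (X.filter fun b => b k ∈ I).card = ∑ j ∈ I, (X.filter fun b => b k = j).card := by
  classical
  rw [Finset.card_eq_sum_card_fiberwise (f := fun b : Equiv.Perm (Fin n) => b k)
    (s := X.filter fun b => b k ∈ I) (t := I) (fun b hb => (Finset.mem_filter.1 hb).2)]
  refine Finset.sum_congr rfl fun j hj => ?_
  congr 1
  ext b
  simp only [Finset.mem_filter]
  constructor
  · rintro ⟨⟨hb, _⟩, h⟩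
    exact ⟨hb, h⟩
  · rintro ⟨hb, h⟩
    exact ⟨⟨hb, by rw [h]; exact hj⟩, h⟩

/-- Hit count through the profile: `#{b ∈ T⁻¹U : b k ∈ I} = |T||U| · Σ_{j ∈ I} dB(j,k)`
(fibring over the value `b k` and `pairMarginal_eq_marginal_image₂`). [folklore] -/
private theorem matchingCells_hit_count {n : ℕ} {T U : Finset (Equiv.Perm (Fin n))}
    (hinj : Set.InjOn (fun xy : Equiv.Perm (Fin n) × Equiv.Perm (Fin n) => xy.1⁻¹ * xy.2)
      (↑T ×ˢ ↑U : Set (Equiv.Perm (Fin n) × Equiv.Perm (Fin n))))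
    (dB : Fin n → Fin n → ℝ)
    (hdB : ∀ j k, dB j k =
      (((T ×ˢ U).filter fun tu => tu.2 k = tu.1 j).card : ℝ) / (T.card * U.card : ℕ))
    (hpos : 0 < T.card * U.card) (k : Fin n) (I : Finset (Fin n)) :
    (((Finset.image₂ (fun x y : Equiv.Perm (Fin n) => x⁻¹ * y) T U).filter
        fun b => b k ∈ I).card : ℝ) = (T.card * U.card : ℕ) * ∑ j ∈ I, dB j k := by
  have hc : ((T.card * U.card : ℕ) : ℝ) ≠ 0 := by exact_mod_cast hpos.ne'
  rw [matchingCells_card_filter_apply_mem, Nat.cast_sum, Finset.mul_sum]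
  refine Finset.sum_congr rfl fun j _ => ?_
  rw [hdB, pairMarginal_eq_marginal_image₂ hinj j k, mul_div_assoc', mul_div_cancel_left₀ _ hc]

/-! ## The two halves of the matching -/

/-- **Big cells cost `A`.** If the cells `e = (k,i) ∈ C` have distinct rows `i`, sets `Q e` of size
`≥ n/16` and `Σ_{j ∈ Q e} dA(i,j) ≤ 1/64`, then `A = S⁻¹T` avoids them
(`#{a ∈ A : a⁻¹ i ∈ Q e} ≤ |A|/64`), so `matching_cost_avoid` and `4·n!/|A| < 64 M ≤ 96 M` give
`|C| ≤ 33100 (1 + log n) log(96 M)`. [folklore] -/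
private theorem matchingCells_big_le {n : ℕ} (hn : 1 ≤ n) {S T : Finset (Equiv.Perm (Fin n))}
    (hinj : Set.InjOn (fun xy : Equiv.Perm (Fin n) × Equiv.Perm (Fin n) => xy.1⁻¹ * xy.2)
      (↑S ×ˢ ↑T : Set (Equiv.Perm (Fin n) × Equiv.Perm (Fin n))))
    (hS0 : S.Nonempty) (hT0 : T.Nonempty) (dA : Fin n → Fin n → ℝ)
    (hdA : ∀ i j, dA i j =
      (((S ×ˢ T).filter fun st => st.2 j = st.1 i).card : ℝ) / (S.card * T.card : ℕ))
    (M : ℝ) (hM : 1 ≤ M) (hKA : (n.factorial : ℝ) / (S.card * T.card : ℕ) < 16 * M)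
    (C : Finset (Fin n × Fin n)) (h2 : Set.InjOn Prod.snd (C : Set (Fin n × Fin n)))
    (Q : Fin n × Fin n → Finset (Fin n)) (hQ : ∀ e ∈ C, (n : ℝ) / 16 ≤ (Q e).card)
    (havoid : ∀ e ∈ C, ∑ j ∈ Q e, dA e.2 j ≤ 1 / 64) :
    (C.card : ℝ) ≤ 33100 * (1 + Real.log n) * Real.log (96 * M) := by
  have hSTpos : 0 < S.card * T.card := mul_pos hS0.card_pos hT0.card_pos
  have hSTR : (0 : ℝ) < (S.card * T.card : ℕ) := by exact_mod_cast hSTpos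
  have hAcard := card_image₂_of_injOn' hinj
  have hAne : (Finset.image₂ (fun x y : Equiv.Perm (Fin n) => x⁻¹ * y) S T).Nonempty :=
    hS0.image₂ hT0
  -- the avoidance hypothesis of `matching_cost_avoid`
  have havoid' : ∀ e ∈ C,
      (((Finset.image₂ (fun x y : Equiv.Perm (Fin n) => x⁻¹ * y) S T).filter
          fun a => a⁻¹ (Prod.snd e) ∈ Q e).card : ℝ) ≤
        (Finset.image₂ (fun x y : Equiv.Perm (Fin n) => x⁻¹ * y) S T).card / 64 := by
    intro e he
    rw [matchingCells_avoid_count hinj dA hdA hSTpos, hAcard]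
    calc ((S.card * T.card : ℕ) : ℝ) * ∑ j ∈ Q e, dA e.2 j
        ≤ (S.card * T.card : ℕ) * (1 / 64) := mul_le_mul_of_nonneg_left (havoid e he) hSTR.le
      _ = ((S.card * T.card : ℕ) : ℝ) / 64 := by ring
  have hcost := matchingCells_cost_avoid hn _ hAne C Prod.snd h2 Q hQ havoid'
  -- `4·n!/|A| ≤ 96 M`
  have hfact : (0 : ℝ) < n.factorial := by exact_mod_cast n.factorial_pos
  have hlog : Real.log (4 * n.factorial /
      (Finset.image₂ (fun x y : Equiv.Perm (Fin n) => x⁻¹ * y) S T).card) ≤ Real.log (96 * M) := by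
    rw [hAcard]
    apply Real.log_le_log (div_pos (by linarith) hSTR)
    have h4 : 4 * (n.factorial : ℝ) / ((S.card * T.card : ℕ) : ℝ) =
        4 * ((n.factorial : ℝ) / ((S.card * T.card : ℕ) : ℝ)) := by ring
    rw [h4]
    linarith
  have hnR : (1 : ℝ) ≤ n := by exact_mod_cast hn
  have hG : 0 ≤ 33100 * (1 + Real.log n) := by linarith [Real.log_nonneg hnR]
  exact hcost.trans (mul_le_mul_of_nonneg_left hlog hG)

/-- **Small cells cost `B`.** If the cells `e = (k,i) ∈ C` have distinct positions `k`, sets `Q e` of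
size `≤ n/8` and `Σ_{j ∈ Q e} dB(j,k) ≥ 1/2`, then `B = T⁻¹U` hits them (`#{b ∈ B : b k ∈ Q e} ≥ |B|/2`),
so `matching_cost_hit` and `6·n!/|B| < 96 M` give `|C| ≤ 330 (1 + log n) log(96 M)`. [folklore] -/
private theorem matchingCells_small_le {n : ℕ} (hn : 1 ≤ n) {T U : Finset (Equiv.Perm (Fin n))}
    (hinj : Set.InjOn (fun xy : Equiv.Perm (Fin n) × Equiv.Perm (Fin n) => xy.1⁻¹ * xy.2)
      (↑T ×ˢ ↑U : Set (Equiv.Perm (Fin n) × Equiv.Perm (Fin n))))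
    (hT0 : T.Nonempty) (hU0 : U.Nonempty) (dB : Fin n → Fin n → ℝ)
    (hdB : ∀ j k, dB j k =
      (((T ×ˢ U).filter fun tu => tu.2 k = tu.1 j).card : ℝ) / (T.card * U.card : ℕ))
    (M : ℝ) (hKB : (n.factorial : ℝ) / (T.card * U.card : ℕ) < 16 * M)
    (C : Finset (Fin n × Fin n)) (h1 : Set.InjOn Prod.fst (C : Set (Fin n × Fin n)))
    (Q : Fin n × Fin n → Finset (Fin n)) (hQ : ∀ e ∈ C, ((Q e).card : ℝ) ≤ n / 8)
    (hhit : ∀ e ∈ C, 1 / 2 ≤ ∑ j ∈ Q e, dB j e.1) :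
    (C.card : ℝ) ≤ 330 * (1 + Real.log n) * Real.log (96 * M) := by
  have hTUpos : 0 < T.card * U.card := mul_pos hT0.card_pos hU0.card_pos
  have hTUR : (0 : ℝ) < (T.card * U.card : ℕ) := by exact_mod_cast hTUpos
  have hBcard := card_image₂_of_injOn' hinj
  have hBne : (Finset.image₂ (fun x y : Equiv.Perm (Fin n) => x⁻¹ * y) T U).Nonempty :=
    hT0.image₂ hU0
  -- the hitting hypothesis of `matching_cost_hit`
  have hhit' : ∀ e ∈ C,
      ((Finset.image₂ (fun x y : Equiv.Perm (Fin n) => x⁻¹ * y) T U).card : ℝ) / 2 ≤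
        ((Finset.image₂ (fun x y : Equiv.Perm (Fin n) => x⁻¹ * y) T U).filter
          fun b => b (Prod.fst e) ∈ Q e).card := by
    intro e he
    rw [matchingCells_hit_count hinj dB hdB hTUpos, hBcard]
    calc ((T.card * U.card : ℕ) : ℝ) / 2 = (T.card * U.card : ℕ) * (1 / 2) := by ring
      _ ≤ (T.card * U.card : ℕ) * ∑ j ∈ Q e, dB j e.1 :=
          mul_le_mul_of_nonneg_left (hhit e he) hTUR.le
  have hcost := matchingCells_cost_hit hn _ hBne C Prod.fst h1 Q hQ hhit'
  -- `6·n!/|B| ≤ 96 M`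
  have hfact : (0 : ℝ) < n.factorial := by exact_mod_cast n.factorial_pos
  have hlog : Real.log (6 * n.factorial /
      (Finset.image₂ (fun x y : Equiv.Perm (Fin n) => x⁻¹ * y) T U).card) ≤ Real.log (96 * M) := by
    rw [hBcard]
    apply Real.log_le_log (div_pos (by linarith) hTUR)
    have h6 : 6 * (n.factorial : ℝ) / ((T.card * U.card : ℕ) : ℝ) =
        6 * ((n.factorial : ℝ) / ((T.card * U.card : ℕ) : ℝ)) := by ring
    rw [h6]
    linarith
  have hnR : (1 : ℝ) ≤ n := by exact_mod_cast hn
  have hG : 0 ≤ 330 * (1 + Real.log n) := by linarith [Real.log_nonneg hnR]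
  exact hcost.trans (mul_le_mul_of_nonneg_left hlog hG)

/-! ## The registered stub -/

/-- **The cost of a scattered matching (two dense quotients).** Let `S, T, U ⊆ S_n` have the triple
product property, all non-empty, with profiles `dA(i,j) = #{(s,t) : t j = s i}/(|S||T|)`,
`dB(j,k) = #{(t,u) : u k = t j}/(|T||U|)` and both quotients dense (`n!/(|S||T|), n!/(|T||U|) < 16 M`,
`M ≥ 1`). Then a matching `Mt` of cells `e = (k,i)` (injective first and second coordinates), each
scattered (`n · Σ_j dA(i,j) dB(j,k) ≤ 1/128`), has `|Mt| ≤ 33430 (1 + log n) log(96 M)`: by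
`scatter_cell` each cell has a set `Q = {j : dB(j,k) ≥ 1/(2n)}` with `Σ_Q dB ≥ 1/2`, `Σ_Q dA ≤ 1/64`;
the cells with `|Q| ≥ n/16` are paid for by `matching_cost_avoid` on `A = S⁻¹T`
(`≤ 33100 (1+log n) log(96M)`), the others by `matching_cost_hit` on `B = T⁻¹U`
(`≤ 330 (1+log n) log(96M)`). [folklore] -/
theorem matchingCells_card_le {n : ℕ} (hn : 1 ≤ n) {S T U : Finset (Equiv.Perm (Fin n))}
    (hTPP : TripleProductProperty S T U) (hS0 : S.Nonempty) (hT0 : T.Nonempty) (hU0 : U.Nonempty)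
    (dA dB : Fin n → Fin n → ℝ)
    (hdA : ∀ i j, dA i j = (((S ×ˢ T).filter fun st => st.2 j = st.1 i).card : ℝ) / (S.card * T.card : ℕ))
    (hdB : ∀ j k, dB j k = (((T ×ˢ U).filter fun tu => tu.2 k = tu.1 j).card : ℝ) / (T.card * U.card : ℕ))
    (M : ℝ) (hM : 1 ≤ M)
    (hKA : (n.factorial : ℝ) / (S.card * T.card : ℕ) < 16 * M)
    (hKB : (n.factorial : ℝ) / (T.card * U.card : ℕ) < 16 * M)
    (Mt : Finset (Fin n × Fin n)) (h1 : Set.InjOn Prod.fst (Mt : Set (Fin n × Fin n)))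
    (h2 : Set.InjOn Prod.snd (Mt : Set (Fin n × Fin n)))
    (hscatter : ∀ e ∈ Mt, (n : ℝ) * ∑ j : Fin n, dA e.2 j * dB j e.1 ≤ 1 / 128) :
    (Mt.card : ℝ) ≤ 33430 * (1 + Real.log n) * Real.log (96 * M) := by
  -- injectivity of the two quotient maps (the triple product property) and basic positivity
  have hinjA := injOn_quot_first hTPP hU0
  have hinjB := injOn_quot_second hTPP hS0
  have hTUpos : 0 < T.card * U.card := mul_pos hT0.card_pos hU0.card_pos
  have hnR : (1 : ℝ) ≤ n := by exact_mod_cast hn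
  have hn0 : (0 : ℝ) < n := by linarith
  have hdA0 : ∀ i j, 0 ≤ dA i j := fun i j => by rw [hdA]; positivity
  have hdB0 : ∀ j k, 0 ≤ dB j k := fun j k => by rw [hdB]; positivity
  have hcolsum : ∀ k, ∑ j, dB j k = 1 := matchingCells_colsum hTUpos dB hdB
  -- the big-`dB` positions `Q e` of a cell `e = (k, i)` and the scattered-cell dichotomy
  obtain ⟨Q, hQ⟩ : ∃ Q : Fin n × Fin n → Finset (Fin n),
      ∀ e, Q e = Finset.univ.filter fun j => 1 / (2 * (n : ℝ)) ≤ dB j e.1 := ⟨_, fun _ => rfl⟩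
  have hcell : ∀ e ∈ Mt,
      1 / 2 ≤ ∑ j ∈ Q e, dB j e.1 ∧ ∑ j ∈ Q e, dA e.2 j ≤ 2 * (1 / 128) := by
    intro e he
    have hfg : ∑ j, dA e.2 j * dB j e.1 ≤ 1 / 128 / n := by
      rw [le_div_iff₀ hn0]
      have := hscatter e he
      linarith
    rw [hQ]
    exact scatter_cell (fun j => dA e.2 j) (fun j => dB j e.1) (1 / 128) (fun j => hdA0 _ _)
      (fun j => hdB0 _ _) (hcolsum e.1) hfg
  -- split the matching by the size of `Q e`
  have hsplit := Finset.card_filter_add_card_filter_not (s := Mt)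
    (fun e => (n : ℝ) / 16 ≤ ((Q e).card : ℝ))
  have hsum : ((Mt.filter fun e => (n : ℝ) / 16 ≤ ((Q e).card : ℝ)).card : ℝ) +
      ((Mt.filter fun e => ¬ ((n : ℝ) / 16 ≤ ((Q e).card : ℝ))).card : ℝ) = Mt.card := by
    exact_mod_cast hsplit
  -- big cells: `A = S⁻¹T` avoids
  have hbig : ((Mt.filter fun e => (n : ℝ) / 16 ≤ ((Q e).card : ℝ)).card : ℝ) ≤
      33100 * (1 + Real.log n) * Real.log (96 * M) :=
    matchingCells_big_le hn hinjA hS0 hT0 dA hdA M hM hKA _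
      (h2.mono (Finset.coe_subset.2 (Finset.filter_subset _ _))) Q
      (fun e he => (Finset.mem_filter.1 he).2)
      (fun e he => by have := (hcell e (Finset.mem_filter.1 he).1).2; linarith)
  -- small cells: `B = T⁻¹U` hits
  have hsmall : ((Mt.filter fun e => ¬ ((n : ℝ) / 16 ≤ ((Q e).card : ℝ))).card : ℝ) ≤
      330 * (1 + Real.log n) * Real.log (96 * M) :=
    matchingCells_small_le hn hinjB hT0 hU0 dB hdB M hKB _
      (h1.mono (Finset.coe_subset.2 (Finset.filter_subset _ _))) Q
      (fun e he => by have := not_le.1 (Finset.mem_filter.1 he).2; linarith)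
      (fun e he => (hcell e (Finset.mem_filter.1 he).1).1)
  linarith

end Summit.MatrixMultiplication.MatrixMultiplication.Theorems.PolynomialSlack
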